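import Literature.MathematicalPhysics.QuantumFieldTheory.Balaban1983to89.B4Thm19ZeroBoxHolderRateUnif
import Literature.MathematicalPhysics.QuantumFieldTheory.Balaban1983to89.B4Thm110ZeroBoxMeshOne

/-!
# `Balaban1983to89.B4Thm19ZeroBoxHolderMeshOne` — B4 Theorem (1.9) (the Hölder clause) at `A = 0` on boxes: THE
# MESH-ONE MEMBER `k = 0` (`η = 1`, `G₀(□) = (−Δ^N_□ + m² + a)⁻¹`) and the ALL-SCALES forms (`k ≥ 0`) of
# `thm19_zero_box_holder_roww_coeff` / `thm19_zero_box_holder_roww_coeff_unif` — the binder «1 ≤ k» removed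

statement-level skeleton of published theorems with citation tags; proofs where landed; nothing here is a claim about the Yang–Mills mass gap

**Source.** T. Bałaban, *Regularity and Decay of Lattice Green's Functions*, Commun. Math. Phys. **89**, 571–597 (1983)
(`Balaban1983RegularityDecay`, «B4»): p. 572 [PDF 2] (1.3)–(1.6), p. 573 [PDF 3] the Theorem (1.9)–(1.10), p. 577
[PDF 7] the Hölder norms (2.14), p. 582 [PDF 12] Lemma 2.4 (2.35)–(2.36) «for arbitrary non-negative integer j»
(the sentences are quoted in `B4Thm19ZeroBoxHolder`, `B4Thm110ZeroBoxMeshOne`); T. Bałaban, CMP **96** (1984)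
223–250 (`Balaban1984PropagatorsII`, «B6») p. 229 [PDF 7] (level-0 cubes of the cover), p. 234 [PDF 12] Proposition
2.2 (2.67) (entry 4).  A new leaf; no existing module is touched; nothing of B4 is asserted as a fact; every input is
a kernel-proved theorem of the `B4*` package, USED BY NAME.

## WHY THIS FILE (row G-F3′-L0 of the lit-balaban cell, packet S-B; sequel of `B4Thm110ZeroBoxMeshOne`)

The two-level cube lane of [B6] Prop. 2.2 (entry 4, `B6Ineq243HolderTwoLevelBox`, `B6Prop22HolderTwoLevelBoxRateUnif`)
consumes `B4Thm19ZeroBoxHolder.thm19_zero_box_holder_roww_coeff` and its `∃δ₀∀α∃c₀` re-threading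
`B4Thm19ZeroBoxHolderRateUnif.thm19_zero_box_holder_roww_coeff_unif`, both with the binder `∀ k, 1 ≤ k →` (B4 p. 572
«k is an arbitrary positive integer»).  At mesh one (`k = 0`: `η = 1`, `P₀ = 1`, the massive Neumann resolvent `G₀(□)`
of `B4Thm110ZeroBoxMeshOne`; the `j = 0` member of Lemma 2.4 and the level-0 cube type of [B6] p. 229) the Hölder
weight `(η⁻¹/|x − x′|)^α = |x − x′|_∞^{−α}` is `≤ 1` on distinct lattice points (`|x − x′|_∞ ≥ 1`,
`B4StripSumsHolder.one_le_supNorm`, `B4Thm19ZeroBoxHolder.holderWeight_le`), so (1.9) at mesh one follows from the two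
differenced-row bounds of `B4Thm110ZeroBoxMeshOne.thm110_zero_box_deriv_wsum_meshOne` with an `α`-independent constant.

## WHAT THIS FILE CERTIFIES (kernel-checked, zero `sorry`, no hypotheses; window `a ∈ [a₋, a₊]`, `m² ∈ [0, m²₊]`)

* §1 `thm19_zero_box_holder_wsum2_meshOne` — (1.9) at mesh one, two-centre weighted form, for EVERY `0 ≤ α ≤ 1`:
  `Σ_z |(1/|x′−x|)^α((G₀(xe′,z) − G₀(x′,z)) − (G₀(xe,z) − G₀(x,z)))|e^{δ₀min(|x−z|,|x′−z|)} ≤ c₀` (`x ≠ x′`,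
  `xe = x + e_μ`, `xe′ = x′ + e_μ`), `δ₀, c₀` depending on `d` and the window only;
* §2 the ALL-SCALES forms `thm19_zero_box_holder_roww_coeff_all` (`0 ≤ α < 1` fixed first) and
  `thm19_zero_box_holder_roww_coeff_unif_all` (`∃ δ₀ ∀ α ∃ c₀(α)`): the two lineage theorems with `∀ (k : ℕ), 1 ≤ k →`
  replaced by `∀ (k : ℕ)` (remaining binders unchanged; `k ≥ 1` from the lineage, `k = 0` from §1, rates `min`-merged
  with `B4Thm19ZeroBoxHolder.wsum2_mono_rate`, constants `max`-merged);  §3 non-vacuity (`d + 1 = 4`, `L = 2`, `α = 1/2`).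

## DICTIONARY / HONEST SCOPE

As in `B4Thm110ZeroBoxMeshOne` (mesh one = unit lattice, `G₀ = (boxOpR 1 a m² M)⁻¹`, sup norm, `A = 0`, boxes
`Π_μ[0, M_μ)`, existential constants) and in `B4Thm19ZeroBoxHolder` (its HONEST SCOPE applies verbatim to the `k ≥ 1`
members).  B4 prints (1.9) for «k … an arbitrary positive integer»; the `k = 0` member is the degenerate unit-lattice
case (covered in print by Lemma 2.4 at `j = 0` and by the level-0 cubes of [B6] pp. 229–230); no claim is made that B4
states it verbatim.  At mesh one the Hölder quotient is no regularity statement (`|x − x′|_∞ ≥ 1`), whence the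
`α`-independent constant; `α ≤ 1` enters only through `holderWeight_le`.

**Value = kernel certificate (the unit-lattice member of B4 (1.9) at `A = 0` on boxes and the all-scales forms the
[B6] level-0 cube lane consumes), NOT summit progress**; no Literature fact is minted.
-/

namespace Literature.MathematicalPhysics.QuantumFieldTheory.Balaban1983to89.B4Thm19ZeroBoxHolderMeshOne

open Finset Matrix
open Literature.MathematicalPhysics.QuantumFieldTheory.Balaban1983to89.B4ContourShift
open Literature.MathematicalPhysics.QuantumFieldTheory.Balaban1983to89.B4Reflection242
open Literature.MathematicalPhysics.QuantumFieldTheory.Balaban1983to89.B4Green242Bridge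
open Literature.MathematicalPhysics.QuantumFieldTheory.Balaban1983to89.B4BoxCov237
open Literature.MathematicalPhysics.QuantumFieldTheory.Balaban1983to89.B4Thm110ZeroBox
open Literature.MathematicalPhysics.QuantumFieldTheory.Balaban1983to89.B4Thm110ZeroBoxDeriv
open Literature.MathematicalPhysics.QuantumFieldTheory.Balaban1983to89.B4Thm19ZeroBoxHolder
  (wsum2 wsum2_mono_rate holderWeight_le thm19_zero_box_holder_roww_coeff)
open Literature.MathematicalPhysics.QuantumFieldTheory.Balaban1983to89.B4Thm19ZeroBoxHolderRateUnif
  (thm19_zero_box_holder_roww_coeff_unif)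
open Literature.MathematicalPhysics.QuantumFieldTheory.Balaban1983to89.B4Thm110ZeroBoxMeshOne
  (thm110_zero_box_deriv_wsum_meshOne)
open B4StripSumsHolder (one_le_supNorm)

noncomputable section

variable {d : ℕ}

/-! ## §1 Theorem (1.9) at mesh one: the Hölder weight is `≤ 1` on distinct lattice points -/

/-- **THEOREM (1.9), HÖLDER CLAUSE, AT MESH ONE** (two-centre weighted form): there are `δ₀, c₀ > 0` depending on `d`
and the window only such that for EVERY `0 ≤ α ≤ 1`, every `(a, m²)` in the window, every box, axis `μ`, every two
pairs of neighbours `x, xe = x + e_μ` and `x′, xe′ = x′ + e_μ` with `x ≠ x′`: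
`Σ_z |(1/|x′ − x|_∞)^α·1·((G₀(xe′,z) − G₀(x′,z)) − (G₀(xe,z) − G₀(x,z)))|·e^{δ₀min(|x−z|_∞,|x′−z|_∞)} ≤ c₀` —
the weight is `≤ 1` (`|x′ − x|_∞ ≥ 1`, `one_le_supNorm`, `holderWeight_le`), each differenced row is controlled by
`thm110_zero_box_deriv_wsum_meshOne` about its own centre, and `e^{δ₀min} ≤ e^{δ₀|x−z|}, e^{δ₀|x′−z|}` (`c₀ = 2c`).
[cite: Balaban1983RegularityDecay, Theorem (Prop. 2.1 of [1]) (1.9) p.573 with (2.14) p.577, at η = 1] -/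
theorem thm19_zero_box_holder_wsum2_meshOne (d : ℕ) (amin aplus m2plus : ℝ) (ha : 0 < amin) :
    ∃ δ₀ c₀ : ℝ, 0 < δ₀ ∧ 0 < c₀ ∧ ∀ (α : ℝ), 0 ≤ α → α ≤ 1 → ∀ (a m2 : ℝ), amin ≤ a → a ≤ aplus → 0 ≤ m2 →
      m2 ≤ m2plus → ∀ (M : Fin (d + 1) → ℕ) (μ : Fin (d + 1)) (x xe x' xe' : ↥(boxDom (fun i => 1 * M i))),
        xe.1 = x.1 + Pi.single μ 1 → xe'.1 = x'.1 + Pi.single μ 1 → x'.1 ≠ x.1 →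
          ∑ z, |((((1 : ℕ)) : ℝ) / supNorm (x'.1 - x.1)) ^ α * ((((1 : ℕ)) : ℝ) *
                (((boxOpR 1 a m2 M)⁻¹ xe' z - (boxOpR 1 a m2 M)⁻¹ x' z)
                  - ((boxOpR 1 a m2 M)⁻¹ xe z - (boxOpR 1 a m2 M)⁻¹ x z)))|
              * Real.exp (δ₀ * min (supNorm (x.1 - z.1)) (supNorm (x'.1 - z.1)) / (((1 : ℕ)) : ℝ)) ≤ c₀ := by
  obtain ⟨δ₀, c, hδ, hc, h⟩ := thm110_zero_box_deriv_wsum_meshOne d amin aplus m2plus ha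
  refine ⟨δ₀, 2 * c, hδ, by positivity, ?_⟩
  intro α hα0 hα1 a m2 h1 h2 h3 h4 M μ x xe x' xe' hxe hxe' hne
  set G := (boxOpR 1 a m2 M)⁻¹ with hGdef
  have hB := h a m2 h1 h2 h3 h4 M μ x xe hxe
  have hA := h a m2 h1 h2 h3 h4 M μ x' xe' hxe'
  rw [wsum] at hA hB
  have hσ1 : 1 ≤ supNorm (x'.1 - x.1) := one_le_supNorm (sub_ne_zero.2 hne)
  have hw0 : 0 ≤ ((((1 : ℕ)) : ℝ) / supNorm (x'.1 - x.1)) ^ α :=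
    Real.rpow_nonneg (div_nonneg (by positivity) (supNorm_nonneg _)) α
  have hw1 : ((((1 : ℕ)) : ℝ) / supNorm (x'.1 - x.1)) ^ α ≤ 1 := by
    have := holderWeight_le (le_refl 1) hσ1 hα0 hα1
    simpa using this
  have hterm : ∀ z : ↥(boxDom (fun i => 1 * M i)),
      |((((1 : ℕ)) : ℝ) / supNorm (x'.1 - x.1)) ^ α * ((((1 : ℕ)) : ℝ) *
          ((G xe' z - G x' z) - (G xe z - G x z)))|
        * Real.exp (δ₀ * min (supNorm (x.1 - z.1)) (supNorm (x'.1 - z.1)) / (((1 : ℕ)) : ℝ))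
      ≤ |(((1 : ℕ)) : ℝ) * (G xe' z - G x' z)| * Real.exp (δ₀ * supNorm (x'.1 - z.1) / (((1 : ℕ)) : ℝ))
        + |(((1 : ℕ)) : ℝ) * (G xe z - G x z)| * Real.exp (δ₀ * supNorm (x.1 - z.1) / (((1 : ℕ)) : ℝ)) := by
    intro z
    have hsplit : |((((1 : ℕ)) : ℝ) / supNorm (x'.1 - x.1)) ^ α * ((((1 : ℕ)) : ℝ) *
        ((G xe' z - G x' z) - (G xe z - G x z)))|
        ≤ |(((1 : ℕ)) : ℝ) * (G xe' z - G x' z)| + |(((1 : ℕ)) : ℝ) * (G xe z - G x z)| := by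
      rw [abs_mul, abs_of_nonneg hw0]
      calc ((((1 : ℕ)) : ℝ) / supNorm (x'.1 - x.1)) ^ α * |(((1 : ℕ)) : ℝ) *
              ((G xe' z - G x' z) - (G xe z - G x z))|
          ≤ 1 * |(((1 : ℕ)) : ℝ) * ((G xe' z - G x' z) - (G xe z - G x z))| :=
            mul_le_mul_of_nonneg_right hw1 (abs_nonneg _)
        _ = |(((1 : ℕ)) : ℝ) * (G xe' z - G x' z) - (((1 : ℕ)) : ℝ) * (G xe z - G x z)| := by
            rw [one_mul, ← mul_sub]
        _ ≤ _ := abs_sub _ _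
    have he1 : Real.exp (δ₀ * min (supNorm (x.1 - z.1)) (supNorm (x'.1 - z.1)) / (((1 : ℕ)) : ℝ))
        ≤ Real.exp (δ₀ * supNorm (x'.1 - z.1) / (((1 : ℕ)) : ℝ)) :=
      Real.exp_le_exp.2 (div_le_div_of_nonneg_right
        (mul_le_mul_of_nonneg_left (min_le_right _ _) hδ.le) (Nat.cast_nonneg 1))
    have he2 : Real.exp (δ₀ * min (supNorm (x.1 - z.1)) (supNorm (x'.1 - z.1)) / (((1 : ℕ)) : ℝ))
        ≤ Real.exp (δ₀ * supNorm (x.1 - z.1) / (((1 : ℕ)) : ℝ)) :=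
      Real.exp_le_exp.2 (div_le_div_of_nonneg_right
        (mul_le_mul_of_nonneg_left (min_le_left _ _) hδ.le) (Nat.cast_nonneg 1))
    have hE := Real.exp_pos (δ₀ * min (supNorm (x.1 - z.1)) (supNorm (x'.1 - z.1)) / (((1 : ℕ)) : ℝ))
    calc _ ≤ (|(((1 : ℕ)) : ℝ) * (G xe' z - G x' z)| + |(((1 : ℕ)) : ℝ) * (G xe z - G x z)|)
          * Real.exp (δ₀ * min (supNorm (x.1 - z.1)) (supNorm (x'.1 - z.1)) / (((1 : ℕ)) : ℝ)) :=
          mul_le_mul_of_nonneg_right hsplit hE.le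
      _ ≤ _ := by
          rw [add_mul]
          exact add_le_add (mul_le_mul_of_nonneg_left he1 (abs_nonneg _))
            (mul_le_mul_of_nonneg_left he2 (abs_nonneg _))
  calc _ ≤ ∑ z, (|(((1 : ℕ)) : ℝ) * (G xe' z - G x' z)| * Real.exp (δ₀ * supNorm (x'.1 - z.1) / (((1 : ℕ)) : ℝ))
        + |(((1 : ℕ)) : ℝ) * (G xe z - G x z)| * Real.exp (δ₀ * supNorm (x.1 - z.1) / (((1 : ℕ)) : ℝ))) :=
        Finset.sum_le_sum fun z _ => hterm z
    _ ≤ c + c := by rw [Finset.sum_add_distrib]; exact add_le_add hA hB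
    _ = 2 * c := by ring

/-! ## §2 THE ALL-SCALES FORMS (`k ≥ 0`): the two lineage theorems with the binder «1 ≤ k» removed -/

/-- **THEOREM (1.9), HÖLDER CLAUSE, AT `A = 0` FOR BOXES WITH THE LITERAL COEFFICIENT, ALL SCALES `k ≥ 0`**
(two-centre weighted-row form, `0 ≤ α < 1`): `B4Thm19ZeroBoxHolder.thm19_zero_box_holder_roww_coeff` (`k ≥ 1`) and
`thm19_zero_box_holder_wsum2_meshOne` (`k = 0`), constants merged.
[cite: Balaban1983RegularityDecay, Theorem (Prop. 2.1 of [1]) (1.9) p.573 with (1.6) p.572] -/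
theorem thm19_zero_box_holder_roww_coeff_all (d ℓ : ℕ) (hℓ : 1 ≤ ℓ) (amin aplus m2plus : ℝ) (ha : 0 < amin)
    (α : ℝ) (hα0 : 0 ≤ α) (hα1 : α < 1) :
    ∃ δ₀ c₀ : ℝ, 0 < δ₀ ∧ 0 < c₀ ∧ ∀ (k : ℕ) (a m2 : ℝ), amin ≤ a → a ≤ aplus → 0 ≤ m2 →
      m2 ≤ m2plus → ∀ (M : Fin (d + 1) → ℕ), (∀ i, 1 ≤ M i) →
        ∀ (μ : Fin (d + 1)) (x xe x' xe' : ↥(boxDom (fun i => (ℓ + 1) ^ k * M i))),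
          xe.1 = x.1 + Pi.single μ 1 → xe'.1 = x'.1 + Pi.single μ 1 → x'.1 ≠ x.1 →
          ∑ z, |((((ℓ + 1) ^ k : ℕ) : ℝ) / supNorm (x'.1 - x.1)) ^ α * ((((ℓ + 1) ^ k : ℕ) : ℝ) *
                (((boxOpR ((ℓ + 1) ^ k) a m2 M)⁻¹ xe' z - (boxOpR ((ℓ + 1) ^ k) a m2 M)⁻¹ x' z)
                  - ((boxOpR ((ℓ + 1) ^ k) a m2 M)⁻¹ xe z - (boxOpR ((ℓ + 1) ^ k) a m2 M)⁻¹ x z)))|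
              * Real.exp (δ₀ * min (supNorm (x.1 - z.1)) (supNorm (x'.1 - z.1)) / (((ℓ + 1) ^ k : ℕ) : ℝ))
            ≤ c₀ := by
  obtain ⟨δ₁, c₁, hδ₁, hc₁, h₁⟩ := thm19_zero_box_holder_roww_coeff d ℓ hℓ amin aplus m2plus ha α hα0 hα1
  obtain ⟨δ₂, c₂, hδ₂, hc₂, h₂⟩ := thm19_zero_box_holder_wsum2_meshOne d amin aplus m2plus ha
  refine ⟨min δ₁ δ₂, max c₁ c₂, lt_min hδ₁ hδ₂, lt_max_of_lt_left hc₁, ?_⟩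
  intro k
  rcases Nat.eq_zero_or_pos k with rfl | hk
  · intro a m2 h1 h2 h3 h4 M _ μ x xe x' xe' hxe hxe' hne
    have hx := h₂ α hα0 hα1.le a m2 h1 h2 h3 h4 M μ x xe x' xe' hxe hxe' hne
    have hm := wsum2_mono_rate (min_le_right δ₁ δ₂) 1 x x'
      (fun z => ((((1 : ℕ)) : ℝ) / supNorm (x'.1 - x.1)) ^ α * ((((1 : ℕ)) : ℝ) *
        (((boxOpR 1 a m2 M)⁻¹ xe' z - (boxOpR 1 a m2 M)⁻¹ x' z)
          - ((boxOpR 1 a m2 M)⁻¹ xe z - (boxOpR 1 a m2 M)⁻¹ x z))))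
    unfold wsum2 at hm
    exact (hm.trans hx).trans (le_max_right _ _)
  · intro a m2 h1 h2 h3 h4 M hM μ x xe x' xe' hxe hxe' hne
    have hx := h₁ k hk a m2 h1 h2 h3 h4 M hM μ x xe x' xe' hxe hxe' hne
    have hm := wsum2_mono_rate (min_le_left δ₁ δ₂) ((ℓ + 1) ^ k) x x'
      (fun z => ((((ℓ + 1) ^ k : ℕ) : ℝ) / supNorm (x'.1 - x.1)) ^ α * ((((ℓ + 1) ^ k : ℕ) : ℝ) *
        (((boxOpR ((ℓ + 1) ^ k) a m2 M)⁻¹ xe' z - (boxOpR ((ℓ + 1) ^ k) a m2 M)⁻¹ x' z)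
          - ((boxOpR ((ℓ + 1) ^ k) a m2 M)⁻¹ xe z - (boxOpR ((ℓ + 1) ^ k) a m2 M)⁻¹ x z))))
    unfold wsum2 at hm
    exact (hm.trans hx).trans (le_max_left _ _)

/-- **(1.9) AT `A = 0` ON BOXES, LITERAL COEFFICIENT, PRINTED QUANTIFIER ORDER `∃ δ₀ ∀ α ∃ c₀(α)`, ALL SCALES `k ≥ 0`**:
`B4Thm19ZeroBoxHolderRateUnif.thm19_zero_box_holder_roww_coeff_unif` (`k ≥ 1`) merged with
`thm19_zero_box_holder_wsum2_meshOne` (`k = 0`) — the form consumed by the level-0 twin of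
`B6Ineq243HolderTwoLevelBox.ineq243_twoLevel_holder_wsum2`.
[cite: Balaban1983RegularityDecay, Theorem (Prop. 2.1 of [1]) (1.9) p.573 with (1.6) p.572] -/
theorem thm19_zero_box_holder_roww_coeff_unif_all (d ℓ : ℕ) (hℓ : 1 ≤ ℓ) (amin aplus m2plus : ℝ) (ha : 0 < amin) :
    ∃ δ₀ : ℝ, 0 < δ₀ ∧ ∀ (α : ℝ), 0 ≤ α → α < 1 → ∃ c₀ : ℝ, 0 < c₀ ∧ ∀ (k : ℕ) (a m2 : ℝ), amin ≤ a →
      a ≤ aplus → 0 ≤ m2 → m2 ≤ m2plus → ∀ (M : Fin (d + 1) → ℕ), (∀ i, 1 ≤ M i) →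
        ∀ (μ : Fin (d + 1)) (x xe x' xe' : ↥(boxDom (fun i => (ℓ + 1) ^ k * M i))),
          xe.1 = x.1 + Pi.single μ 1 → xe'.1 = x'.1 + Pi.single μ 1 → x'.1 ≠ x.1 →
          ∑ z, |((((ℓ + 1) ^ k : ℕ) : ℝ) / supNorm (x'.1 - x.1)) ^ α * ((((ℓ + 1) ^ k : ℕ) : ℝ) *
                (((boxOpR ((ℓ + 1) ^ k) a m2 M)⁻¹ xe' z - (boxOpR ((ℓ + 1) ^ k) a m2 M)⁻¹ x' z)
                  - ((boxOpR ((ℓ + 1) ^ k) a m2 M)⁻¹ xe z - (boxOpR ((ℓ + 1) ^ k) a m2 M)⁻¹ x z)))|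
              * Real.exp (δ₀ * min (supNorm (x.1 - z.1)) (supNorm (x'.1 - z.1)) / (((ℓ + 1) ^ k : ℕ) : ℝ))
            ≤ c₀ := by
  obtain ⟨δ₁, hδ₁, hA⟩ := thm19_zero_box_holder_roww_coeff_unif d ℓ hℓ amin aplus m2plus ha
  obtain ⟨δ₂, c₂, hδ₂, hc₂, h₂⟩ := thm19_zero_box_holder_wsum2_meshOne d amin aplus m2plus ha
  refine ⟨min δ₁ δ₂, lt_min hδ₁ hδ₂, fun α hα0 hα1 => ?_⟩
  obtain ⟨c₁, hc₁, h₁⟩ := hA α hα0 hα1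
  refine ⟨max c₁ c₂, lt_max_of_lt_left hc₁, ?_⟩
  intro k
  rcases Nat.eq_zero_or_pos k with rfl | hk
  · intro a m2 h1 h2 h3 h4 M _ μ x xe x' xe' hxe hxe' hne
    have hx := h₂ α hα0 hα1.le a m2 h1 h2 h3 h4 M μ x xe x' xe' hxe hxe' hne
    have hm := wsum2_mono_rate (min_le_right δ₁ δ₂) 1 x x'
      (fun z => ((((1 : ℕ)) : ℝ) / supNorm (x'.1 - x.1)) ^ α * ((((1 : ℕ)) : ℝ) *
        (((boxOpR 1 a m2 M)⁻¹ xe' z - (boxOpR 1 a m2 M)⁻¹ x' z)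
          - ((boxOpR 1 a m2 M)⁻¹ xe z - (boxOpR 1 a m2 M)⁻¹ x z))))
    unfold wsum2 at hm
    exact (hm.trans hx).trans (le_max_right _ _)
  · intro a m2 h1 h2 h3 h4 M hM μ x xe x' xe' hxe hxe' hne
    have hx := h₁ k hk a m2 h1 h2 h3 h4 M hM μ x xe x' xe' hxe hxe' hne
    have hm := wsum2_mono_rate (min_le_left δ₁ δ₂) ((ℓ + 1) ^ k) x x'
      (fun z => ((((ℓ + 1) ^ k : ℕ) : ℝ) / supNorm (x'.1 - x.1)) ^ α * ((((ℓ + 1) ^ k : ℕ) : ℝ) *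
        (((boxOpR ((ℓ + 1) ^ k) a m2 M)⁻¹ xe' z - (boxOpR ((ℓ + 1) ^ k) a m2 M)⁻¹ x' z)
          - ((boxOpR ((ℓ + 1) ^ k) a m2 M)⁻¹ xe z - (boxOpR ((ℓ + 1) ^ k) a m2 M)⁻¹ x z))))
    unfold wsum2 at hm
    exact (hm.trans hx).trans (le_max_left _ _)

/-! ## §3 Non-vacuity (`d + 1 = 4`, `L = 2`, `α = 1/2`, window `a ∈ [1/2, 2]`, `m² ∈ [0, 1]`) -/

/-- the all-scales Hölder clause at the physical dimension `d + 1 = 4`, `L = 2`, `α = 1/2`. -/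
example : ∃ δ₀ c₀ : ℝ, 0 < δ₀ ∧ 0 < c₀ ∧ ∀ (k : ℕ) (a m2 : ℝ), (1 / 2 : ℝ) ≤ a → a ≤ 2 → 0 ≤ m2 →
      m2 ≤ 1 → ∀ (M : Fin (3 + 1) → ℕ), (∀ i, 1 ≤ M i) →
        ∀ (μ : Fin (3 + 1)) (x xe x' xe' : ↥(boxDom (fun i => (1 + 1) ^ k * M i))),
          xe.1 = x.1 + Pi.single μ 1 → xe'.1 = x'.1 + Pi.single μ 1 → x'.1 ≠ x.1 →
          ∑ z, |((((1 + 1) ^ k : ℕ) : ℝ) / supNorm (x'.1 - x.1)) ^ (1 / 2 : ℝ) * ((((1 + 1) ^ k : ℕ) : ℝ) *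
                (((boxOpR ((1 + 1) ^ k) a m2 M)⁻¹ xe' z - (boxOpR ((1 + 1) ^ k) a m2 M)⁻¹ x' z)
                  - ((boxOpR ((1 + 1) ^ k) a m2 M)⁻¹ xe z - (boxOpR ((1 + 1) ^ k) a m2 M)⁻¹ x z)))|
              * Real.exp (δ₀ * min (supNorm (x.1 - z.1)) (supNorm (x'.1 - z.1)) / (((1 + 1) ^ k : ℕ) : ℝ))
            ≤ c₀ :=
  thm19_zero_box_holder_roww_coeff_all 3 1 le_rfl (1 / 2) 2 1 (by norm_num) (1 / 2) (by norm_num) (by norm_num)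

/-- the mesh-one binders are inhabited: window `a = 1`, `m² = 0`, the cube `M ≡ 2` (`k = 0` box `{0,1}^4`), the axis
`μ = 0`, the distinct points `x = 0`, `x′ = e_1` with their `μ`-neighbours `xe = e_0`, `xe′ = e_1 + e_0` in the box. -/
example : (1 / 2 : ℝ) ≤ 1 ∧ (1 : ℝ) ≤ 2 ∧ (0 : ℝ) ≤ 0 ∧ (0 : ℝ) ≤ 1
    ∧ (Pi.single (1 : Fin (3 + 1)) (1 : ℤ) : Fin (3 + 1) → ℤ) ≠ (fun _ => (0 : ℤ))
    ∧ (Pi.single (1 : Fin (3 + 1)) (1 : ℤ) + Pi.single (0 : Fin (3 + 1)) (1 : ℤ) : Fin (3 + 1) → ℤ)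
        ∈ boxDom (fun i : Fin (3 + 1) => (1 + 1) ^ 0 * (fun _ => 2 : Fin (3 + 1) → ℕ) i) := by
  refine ⟨by norm_num, by norm_num, le_rfl, by norm_num, ?_, ?_⟩
  · intro h
    have := congrFun h 1
    simp at this
  · refine mem_boxDom.2 fun i => ?_
    fin_cases i <;> simp

end

end Literature.MathematicalPhysics.QuantumFieldTheory.Balaban1983to89.B4Thm19ZeroBoxHolderMeshOne
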